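import Literature.Geometry.Kaehler.ComplexTorusSimpleNonAlgebraicSubvarieties
import Literature.Geometry.Kaehler.ComplexTorusHodgeGroupSpecialLinearGeneral
import Literature.Geometry.Kaehler.ComplexTorusSemipositiveConeEffective
import Literature.Geometry.Kaehler.ComplexTorusZuckerNoCurves
import Literature.Geometry.Kaehler.AnalyticSetZeroDimensional
import HarnessLib

/-!
# Complex tori without subvarieties are simple and non-algebraic; a complex `2`-torus contains no curve iff it is
# simple and not an abelian surface

Layer `Literature/Geometry/Kaehler`, namespace `Literature.Geometry.Kaehler` / `….ComplexTorus`; lane `lit-hodgefound`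
(Track 2 foundations library), Layer A4, row A4-111 of `run/shared/lean/pub/lit-hodgefound/SKELETON.md` (seat skel-4).
Sequel of rows A4-109 (`ComplexTorusHodgeGenericNoSubvarieties.lean`: no closed analytic subset of pure dimension `d`,
`0 < d < g` ⟹ `AnalyticSubsetsFinite`) and A4-110 (`ComplexTorusSimpleNonAlgebraicSubvarieties.lean`: simple ∧ not abelian
∧ `g = 2` ⟹ `AnalyticSubsetsFinite`). This file proves the CONVERSES, so that Voisin's assumption (b) —
`ComplexTorus.AnalyticSubsetsFinite Φ`: every closed analytic `Z ≠ X` is finite — becomes a two-sided notion: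

* §1 (any complex manifold `M` charted on `E`): a closed analytic subset of pure dimension `d > 0` is INFINITE
  (`HasPureDim.infinite`: a finite set has only isolated points, which are regular of codimension `dim E`, while the
  regular points of `Z` have codimension `dim E − d`; uniqueness of the codimension at a regular point), and one of
  pure dimension `d < dim E` is `≠ M` (`HasPureDim.ne_univ_of_lt`).
* §2 (tori): `AnalyticSubsetsFinite Φ ⟺` no closed analytic subset of pure dimension `d` for `0 < d < g`
  (`AnalyticSubsetsFinite.not_hasPureDim`, `analyticSubsetsFinite_iff_forall_not_hasPureDim`, codimension forms);
  transport along the Euclidean presentation (`analyticSubsetsFinite_euclideanPresentation_iff`,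
  `isComplexSubspace_euclideanPresentation_iff`).
* §3 **A TORUS WITHOUT SUBVARIETIES IS SIMPLE** (`AnalyticSubsetsFinite.isSimple`): a complex subtorus `Y = Φ(W)/(W ∩ Λ)`,
  `0 ≠ W ≠ Λ ⊗ ℝ`, is a closed analytic subset of pure dimension `dim Y`, `0 < dim Y < g` (the tree's
  `hasPureDim_image_subtorusMap`, `subRank_eq_two_mul_finrank`).
* §4 **A TORUS OF DIMENSION `g ≥ 2` WITHOUT SUBVARIETIES IS NOT AN ABELIAN VARIETY** (`AnalyticSubsetsFinite.not_isAbelianVariety`):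
  a Riemann form `ω` is a non-zero semi-positive element of `NS(X)`, so `−ω` is a non-empty sum of classes of analytic
  HYPERSURFACES ("the semi-positive cone is the effective cone", Lange Thm. 1.5.11 / Exercise 2.1.6 (10), the tree's
  `semipos_iff_exists_sum_analyticCycleClass_eq`), which have dimension `g − 1 > 0`; equivalently an abelian variety of
  dimension `≥ 2` carries an analytic hypersurface (`IsAbelianVariety.exists_hasPureCodim_one`).
* §5 DIMENSION TWO: **a complex `2`-torus contains no analytic curve (equivalently: no proper closed analytic subset of
  positive dimension) if and only if it is simple and not an abelian surface**
  (`analyticSubsetsFinite_iff_isSimple_and_not_isAbelianVariety`; with A4-110). Instances: Zucker's `T₀ = ℂ²/L₀` has no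
  curves (row A4-105), hence `Zucker.analyticSubsetsFinite`, `Zucker.isSimple`, `Zucker.not_isAbelianVariety`; the
  Hodge-generic `2`-torus `X_J` likewise (A4-109).
* §6 EVERY DIMENSION, BAIRE FORM: with p17's genericity theorem (`ComplexTorusHodgeGroupSpecialLinearGeneral.lean`: the
  period matrices `Z ∈ M_g(ℂ)` with `Hg(X_Z) = SL_{2g}` form a residual set) and row A4-109, **the very general complex
  torus `X_Z = ℂ^g/(Zℤ^g ⊕ ℤ^g)` of ANY dimension `g` contains no proper closed analytic subset of positive dimension**
  (`setOf_analyticSubsetsFinite_mem_residual`, `dense_setOf_analyticSubsetsFinite`), and such tori exist in every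
  dimension (`exists_analyticSubsetsFinite_of_dim`).

Ueno (LNM 439 §10, Thm. 10.3): the subvarieties of Kodaira dimension `0` of a complex torus are exactly the translates of
complex subtori — in particular subtori ARE subvarieties, which is the content of §3; Lange (2023), §2.1 / Swinnerton-Dyer
Ch. II §6: an abelian variety carries (many) positive divisors, the content of §4; Shafarevich (BAG 2, VIII §1.4 Examples
8.3–8.4) describes the `2`-tori with few curves: fibred over an elliptic curve (not simple), or without curves.

Theorems only: no definition, no named fact (`def … : Prop`), no instance, no notation.

## References

* [Ueno1975] K. Ueno, *Classification Theory of Algebraic Varieties and Compact Complex Spaces*, LNM 439 (1975), §10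
  Thm. 10.3 and Thm. 10.9.
* [Lange2023AbelianVarietiesComplex] H. Lange, *Abelian Varieties over the Complex Numbers* (2023), §1.1.6 Exercise (2)(a)
  (subtori), §1.5.4 Thm. 1.5.11, §2.1.1 (p. 78), §2.1.3 Prop. 2.1.11, §2.1.6 Exercise (10)(a), §4.1.
* [SwinnertonDyer1974AbelianVarieties] H. P. F. Swinnerton-Dyer, *Analytic Theory of Abelian Varieties* (1974), Ch. II §6.
* [Shafarevich1994] I. R. Shafarevich, *Basic Algebraic Geometry 2* (1994), Ch. VIII §1.4, Examples 8.3–8.4.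
* [Zucker1977] S. Zucker, Compositio Math. 34 (1977), Appendix B, Theorem p. 208.
* [Voisin2002KaehlerCounterexample] C. Voisin, IMRN 2002 no. 20, §2 (b) and §3.
* [Chirka1989] E. M. Chirka, *Complex Analytic Sets* (1989), §2.3 (regular points, isolated points), §2.4, §5.2.
-/

noncomputable section

open scoped Manifold Topology
open Complex Module Set Function

universe u

namespace Literature.Geometry.Kaehler

/-! ### §1 Positive-dimensional analytic subsets are infinite; pure dimension `< dim M` means proper -/

section Manifold

variable {E : Type*} [NormedAddCommGroup E] [NormedSpace ℂ E] [FiniteDimensional ℂ E]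
  {M : Type*} [TopologicalSpace M] [ChartedSpace E M] [IsManifold 𝓘(ℂ, E) 1 M]

/-- In a `T₁` space every point of a finite set is isolated in it. [folklore] -/
private theorem exists_nhds_inter_subset_singleton_of_finite [T1Space M] {Z : Set M} (hZ : Z.Finite) {a : M} :
    ∃ U ∈ 𝓝 a, U ∩ Z ⊆ {a} := by
  refine ⟨(Z \ {a})ᶜ, ((hZ.subset Set.sdiff_subset).isClosed.isOpen_compl).mem_nhds (by simp), ?_⟩
  rintro y ⟨hyU, hyZ⟩
  by_contra hya
  exact hyU ⟨hyZ, hya⟩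

/-- **A closed analytic subset of pure dimension `d > 0` is infinite.** If `Z` were finite, each of its points would be
isolated, hence a regular point of codimension `dim E` (`isRegularPointOfCodim_finrank_of_isolated`); but `Z` has a regular
point (density of the regular locus), which is regular of codimension `dim E − d < dim E` — contradicting the uniqueness
of the codimension at a regular point. [cite: Chirka1989, §2.3 (p. 23) and §2.4] -/
theorem HasPureDim.infinite [T1Space M] {Z : Set M} {d : ℕ} (hZ : HasPureDim 𝓘(ℂ, E) Z d) (hd : 0 < d) :
    Z.Infinite := by
  intro hfin
  obtain ⟨c, hdc, hZan, ⟨x, hx⟩, hreg⟩ := hZ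
  have hne : (regularLocus 𝓘(ℂ, E) Z).Nonempty := by
    by_contra h
    rw [Set.not_nonempty_iff_eq_empty] at h
    have hcl := IsAnalyticSet.subset_closure_regularLocus_holds 𝓘(ℂ, E) M hZan hx
    rw [h, closure_empty] at hcl
    exact hcl
  obtain ⟨y, hy⟩ := hne
  have hyc : IsRegularPointOfCodim 𝓘(ℂ, E) Z c y := hreg y hy
  have hyn : IsRegularPointOfCodim 𝓘(ℂ, E) Z (finrank ℂ E) y :=
    isRegularPointOfCodim_finrank_of_isolated hy.1 (exists_nhds_inter_subset_singleton_of_finite hfin)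
  have := hyc.codim_unique hy.1 hyn
  omega

/-- **A closed analytic subset of pure dimension `d < dim M` is a proper subset** (its regular points have positive
codimension, while every point of `M` is a regular point of codimension `0` of `M`). [cite: Chirka1989, §2.3–§2.4] -/
theorem HasPureDim.ne_univ_of_lt [Nonempty M] {Z : Set M} {d : ℕ} (hZ : HasPureDim 𝓘(ℂ, E) Z d)
    (hd : d < finrank ℂ E) : Z ≠ univ := by
  obtain ⟨c, hdc, -, -, hreg⟩ := hZ
  refine ne_univ_of_forall_regularLocus_le (I := 𝓘(ℂ, E)) (p := c) (by omega) fun x hx q hq ↦ ?_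
  rw [(hreg x hx).codim_unique hx.1 hq]

end Manifold

namespace ComplexTorus

/-! ### §2 `AnalyticSubsetsFinite` ⟺ no closed analytic subset of pure dimension `d`, `0 < d < g` -/

section Torus

variable {ι : Type*} [Fintype ι] [DecidableEq ι] {E : Type*} [NormedAddCommGroup E] [NormedSpace ℂ E]
  [FiniteDimensional ℂ E] (Φ : (ι → ℝ) ≃L[ℝ] E)

omit [DecidableEq ι] in
/-- **If every closed analytic `Z ≠ X` is finite, then `X` has no closed analytic subset of pure dimension `d` for
`0 < d < g`** (such a subset is infinite and proper, §1) — the converse of row A4-109's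
`analyticSubsetsFinite_of_forall_not_hasPureDim`. [cite: Chirka1989, §2.3–§2.4] [cite: Voisin2002KaehlerCounterexample, §2 (b)] -/
theorem AnalyticSubsetsFinite.not_hasPureDim {Φ : (ι → ℝ) ≃L[ℝ] E} (h : AnalyticSubsetsFinite Φ) {d : ℕ} (hd0 : 0 < d)
    (hdg : d < finrank ℂ E) (Z : Set (ComplexTorus Φ)) : ¬ HasPureDim 𝓘(ℂ, E) Z d :=
  fun hZ ↦ hZ.infinite hd0 (h Z hZ.isAnalyticSet (hZ.ne_univ_of_lt hdg))

omit [DecidableEq ι] in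
/-- Codimension form: no closed analytic subset of pure codimension `c`, `0 < c < g`, on a torus all of whose proper closed
analytic subsets are finite. [cite: Chirka1989, §2.3–§2.4] [cite: Voisin2002KaehlerCounterexample, §2 (b)] -/
theorem AnalyticSubsetsFinite.not_hasPureCodim {Φ : (ι → ℝ) ≃L[ℝ] E} (h : AnalyticSubsetsFinite Φ) {c : ℕ} (hc0 : 0 < c)
    (hcg : c < finrank ℂ E) (Z : Set (ComplexTorus Φ)) : ¬ HasPureCodim 𝓘(ℂ, E) Z c :=
  fun hZ ↦ h.not_hasPureDim (d := finrank ℂ E - c) (by omega) (by omega) Z ⟨c, by omega, hZ⟩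

omit [DecidableEq ι] in
/-- **`AnalyticSubsetsFinite Φ` ⟺ `X` has no closed analytic subset of pure dimension `d` for `0 < d < g`.**
[cite: Chirka1989, §3.3 Prop. 1 and §5.2 Thms. 1–2] [cite: Voisin2002KaehlerCounterexample, §2 (b)] -/
theorem analyticSubsetsFinite_iff_forall_not_hasPureDim :
    AnalyticSubsetsFinite Φ ↔ ∀ d : ℕ, 0 < d → d < finrank ℂ E → ∀ Z : Set (ComplexTorus Φ), ¬ HasPureDim 𝓘(ℂ, E) Z d :=
  ⟨fun h _ hd0 hdg Z ↦ h.not_hasPureDim hd0 hdg Z, analyticSubsetsFinite_of_forall_not_hasPureDim Φ⟩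

omit [DecidableEq ι] in
/-- Codimension form of the equivalence. [cite: Chirka1989, §3.3 Prop. 1 and §5.2 Thms. 1–2] -/
theorem analyticSubsetsFinite_iff_forall_not_hasPureCodim :
    AnalyticSubsetsFinite Φ ↔ ∀ c : ℕ, 0 < c → c < finrank ℂ E → ∀ Z : Set (ComplexTorus Φ), ¬ HasPureCodim 𝓘(ℂ, E) Z c :=
  ⟨fun h _ hc0 hcg Z ↦ h.not_hasPureCodim hc0 hcg Z, analyticSubsetsFinite_of_forall_not_hasPureCodim Φ⟩

/-! #### Transport along the Euclidean presentation -/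

omit [DecidableEq ι] [FiniteDimensional ℂ E] in
/-- `Φ(W)` is a complex subspace iff it is one for the Euclidean presentation (the change of model is `ℂ`-linear).
[cite: Lange2023AbelianVarietiesComplex, §1.1.2 Lemma 1.1.11 and §1.1.6 Exercise (2)(a)] -/
theorem isComplexSubspace_euclideanPresentation_iff [FiniteDimensional ℂ E] (W : Submodule ℝ (ι → ℝ)) :
    IsComplexSubspace (euclideanPresentation Φ) W ↔ IsComplexSubspace Φ W := by
  refine forall₂_congr fun v _ ↦ ?_
  have h : (euclideanPresentation Φ).symm (I • euclideanPresentation Φ v) = Φ.symm (I • Φ v) := by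
    apply (euclideanPresentation Φ).injective
    rw [ContinuousLinearEquiv.apply_symm_apply, euclideanPresentation_apply, euclideanPresentation_apply,
      ContinuousLinearEquiv.apply_symm_apply, map_smul]
  rw [h]

/-- **`AnalyticSubsetsFinite` does not depend on the model**: the change of presentation `ρ(1)` is a biholomorphic
group isomorphism, so closed analytic subsets, properness and finiteness correspond.
[cite: Lange2023AbelianVarietiesComplex, §1.1.2 Lemma 1.1.11] [cite: Chirka1989, §2.3] -/
theorem analyticSubsetsFinite_euclideanPresentation_iff :
    AnalyticSubsetsFinite (euclideanPresentation Φ) ↔ AnalyticSubsetsFinite Φ := by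
  constructor
  · intro h Z hZ hZu
    have hZ' : IsAnalyticSet 𝓘(ℂ, EuclideanSpace ℂ (Fin (finrank ℂ E))) (euclideanPresentationHomeomorph Φ ⁻¹' Z) :=
      hZ.preimage (mdifferentiable_euclideanPresentationHomeomorph Φ)
    have hZu' : euclideanPresentationHomeomorph Φ ⁻¹' Z ≠ univ := fun hu ↦ hZu (by
      rw [← (euclideanPresentationHomeomorph Φ).image_preimage Z, hu, Set.image_univ,
        (euclideanPresentationHomeomorph Φ).range_coe])
    have hfin := h _ hZ' hZu'
    rw [← (euclideanPresentationHomeomorph Φ).image_preimage Z]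
    exact hfin.image _
  · intro h Z hZ hZu
    have hZ' : IsAnalyticSet 𝓘(ℂ, E) ((euclideanPresentationHomeomorph Φ).symm ⁻¹' Z) :=
      hZ.preimage (mdifferentiable_euclideanPresentationHomeomorph_symm Φ)
    have hZu' : (euclideanPresentationHomeomorph Φ).symm ⁻¹' Z ≠ univ := fun hu ↦ hZu (by
      rw [← (euclideanPresentationHomeomorph Φ).symm.image_preimage Z, hu, Set.image_univ,
        (euclideanPresentationHomeomorph Φ).symm.range_coe])
    have hfin := h _ hZ' hZu'
    rw [← (euclideanPresentationHomeomorph Φ).symm.image_preimage Z]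
    exact hfin.image _

end Torus

/-! ### §3 A torus without subvarieties is simple -/

section Simple

variable {ι : Type*} [Fintype ι] [DecidableEq ι] {E : Type u} [NormedAddCommGroup E] [InnerProductSpace ℂ E]
  [FiniteDimensional ℂ E] [MeasurableSpace E] [BorelSpace E] (Φ : (ι → ℝ) ≃L[ℝ] E)

omit [DecidableEq ι] [MeasurableSpace E] [BorelSpace E] in
/-- **A complex subtorus is a closed analytic subset of pure dimension `dim Y`** with `0 < dim Y < g` when
`0 ≠ W ≠ Λ ⊗ ℝ` (inner-product model; the tree's `hasPureDim_image_subtorusMap` applied to `Y` itself).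
[cite: Ueno1975, §10 Thm. 10.3] [cite: Lange2023AbelianVarietiesComplex, §1.1.6 Exercise (2)(a)] -/
theorem hasPureDim_image_subtorusMap_univ {W : Submodule ℝ (ι → ℝ)} (hW : IsLatticeSubspace W)
    (hWc : IsComplexSubspace Φ W) :
    HasPureDim 𝓘(ℂ, E) (mapMatrix (subtorusPeriod Φ W hW hWc) Φ (subtorusMatrix W) '' univ) (finrank ℂ (cxSpan Φ W)) :=
  hasPureDim_image_subtorusMap Φ W hW hWc hasPureDim_univ

omit [DecidableEq ι] [MeasurableSpace E] [BorelSpace E] in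
/-- The dimension of a non-trivial proper complex subtorus lies strictly between `0` and `g`:
`rk (W ∩ Λ) = dim_ℝ W = 2 dim_ℂ Φ(W)`. [cite: Lange2023AbelianVarietiesComplex, §1.1.6 Exercise (2)(a)] -/
theorem finrank_cxSpan_pos_and_lt {W : Submodule ℝ (ι → ℝ)} (hW : IsLatticeSubspace W) (hWc : IsComplexSubspace Φ W)
    (h0 : W ≠ ⊥) (h1 : W ≠ ⊤) : 0 < finrank ℂ (cxSpan Φ W) ∧ finrank ℂ (cxSpan Φ W) < finrank ℂ E := by
  have hsub : finrank ℝ W = 2 * finrank ℂ (cxSpan Φ W) := by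
    rw [finrank_eq_subRank hW, subRank_eq_two_mul_finrank Φ hW hWc]
  have hcard := card_eq_two_mul_finrank Φ
  have hpos : 0 < finrank ℝ W := by
    rw [Module.finrank_pos_iff_exists_ne_zero]
    obtain ⟨w, hw, hw0⟩ := (Submodule.ne_bot_iff W).1 h0
    exact ⟨⟨w, hw⟩, fun h ↦ hw0 (by simpa using congrArg Subtype.val h)⟩
  have hlt : finrank ℝ W < finrank ℝ (ι → ℝ) := Submodule.finrank_lt h1
  rw [Module.finrank_fintype_fun_eq_card] at hlt
  constructor <;> omega

omit [DecidableEq ι] [MeasurableSpace E] [BorelSpace E] in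
/-- **A COMPLEX TORUS ALL OF WHOSE PROPER CLOSED ANALYTIC SUBSETS ARE FINITE IS SIMPLE** (inner-product model): a complex
subtorus `Y`, `0 ≠ Y ≠ X`, would be a closed analytic subset of pure dimension `dim Y`, `0 < dim Y < g`.
[cite: Ueno1975, §10 Thm. 10.3] [cite: Lange2023AbelianVarietiesComplex, §1.1.6 Exercise (2)(a)] -/
theorem AnalyticSubsetsFinite.isSimple_of_inner {Φ : (ι → ℝ) ≃L[ℝ] E} (h : AnalyticSubsetsFinite Φ) : IsSimple Φ := by
  intro W hW hWc
  by_contra hne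
  push Not at hne
  obtain ⟨hpos, hlt⟩ := finrank_cxSpan_pos_and_lt Φ hW hWc hne.1 hne.2
  exact h.not_hasPureDim hpos hlt _ (hasPureDim_image_subtorusMap_univ Φ hW hWc)

end Simple

section SimpleAnyModel

variable {ι : Type*} [Fintype ι] [DecidableEq ι] {E : Type*} [NormedAddCommGroup E] [NormedSpace ℂ E]
  [FiniteDimensional ℂ E] (Φ : (ι → ℝ) ≃L[ℝ] E)

/-- **A COMPLEX TORUS WITHOUT SUBVARIETIES IS SIMPLE — any finite-dimensional model** (transport along the Euclidean
presentation: `AnalyticSubsetsFinite` and `IsSimple` are invariant).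
[cite: Ueno1975, §10 Thm. 10.3] [cite: Lange2023AbelianVarietiesComplex, §1.1.6 Exercise (2)(a) and (5)(b)] -/
theorem AnalyticSubsetsFinite.isSimple {Φ : (ι → ℝ) ≃L[ℝ] E} (h : AnalyticSubsetsFinite Φ) : IsSimple Φ :=
  (isSimple_euclideanPresentation_iff Φ).1
    (AnalyticSubsetsFinite.isSimple_of_inner ((analyticSubsetsFinite_euclideanPresentation_iff Φ).2 h))

end SimpleAnyModel

/-! ### §4 An abelian variety of dimension `≥ 1` carries an analytic hypersurface; a torus of dimension `≥ 2` without
subvarieties is not an abelian variety -/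

section Abelian

variable {ι : Type*} [Fintype ι] [DecidableEq ι] {E : Type u} [NormedAddCommGroup E] [InnerProductSpace ℂ E]
  [FiniteDimensional ℂ E] [MeasurableSpace E] [BorelSpace E] (Φ : (ι → ℝ) ≃L[ℝ] E)

/-- **An abelian variety of positive dimension carries an analytic hypersurface** (inner-product model): a Riemann form
`ω` is a non-zero semi-positive element of `NS(X)`, so `−ω` is the class of a non-empty sum of analytic hypersurfaces
("the semi-positive cone is the effective cone", the tree's `semipos_iff_exists_sum_analyticCycleClass_eq`; a theta
divisor). [cite: Lange2023AbelianVarietiesComplex, §1.5.4 Thm. 1.5.11, §2.1.1 (p. 78) and §2.1.6 Exercise (10)(a)]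
[cite: SwinnertonDyer1974AbelianVarieties, Ch. II §6] -/
theorem IsAbelianVariety.exists_hasPureDim_of_inner {Φ : (ι → ℝ) ≃L[ℝ] E} (hab : IsAbelianVariety Φ)
    (hg : 1 ≤ finrank ℂ E) : ∃ D : Set (ComplexTorus Φ), HasPureDim 𝓘(ℂ, E) D (finrank ℂ E - 1) := by
  obtain ⟨ω, hω⟩ := hab
  obtain ⟨e⟩ := nonempty_fin_two_mul_finrank_equiv Φ
  obtain ⟨e', he'⟩ := exists_orientationSign_eq_one Φ e
  have hsemi : IsNSForm Φ ω ∧ ∀ u : E, 0 ≤ ω ![I • u, u] := by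
    refine ⟨hω.isNSForm Φ, fun u ↦ ?_⟩
    by_cases hu : u = 0
    · subst hu
      have : ω ![I • (0 : E), 0] = 0 := ω.map_coord_zero 1 rfl
      rw [this]
    · exact (hω.2.2 u hu).le
  obtain ⟨k, Y, hsum⟩ := (semipos_iff_exists_sum_analyticCycleClass_eq Φ e' (d := finrank ℂ E - 1) (by omega) he' ω).1 hsemi
  rcases Nat.eq_zero_or_pos k with hk | hk
  · subst hk
    rw [Finset.univ_eq_empty, Finset.sum_empty] at hsum
    haveI : Nontrivial E := Module.nontrivial_of_finrank_pos (R := ℂ) (by omega)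
    have hω0 : ω = 0 := by
      have h0 : ofRealForm (-ω) = ofRealForm (-(0 : E [⋀^Fin 2]→L[ℝ] ℝ)) := by rw [hsum, neg_zero]; ext v; simp
      exact neg_injective (ofRealForm_injective h0)
    exact absurd hω0 (hω.ne_zero)
  · exact ⟨(Y ⟨0, hk⟩).1, (Y ⟨0, hk⟩).2⟩

/-- **A torus of dimension `g ≥ 2` all of whose proper closed analytic subsets are finite is not an abelian variety**
(inner-product model). [cite: Lange2023AbelianVarietiesComplex, §2.1.3 Prop. 2.1.11 and §4.1] [cite: Voisin2002KaehlerCounterexample, §3] -/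
theorem AnalyticSubsetsFinite.not_isAbelianVariety_of_inner {Φ : (ι → ℝ) ≃L[ℝ] E} (h : AnalyticSubsetsFinite Φ)
    (hg : 2 ≤ finrank ℂ E) : ¬ IsAbelianVariety Φ := fun hab ↦ by
  obtain ⟨D, hD⟩ := hab.exists_hasPureDim_of_inner (by omega)
  exact h.not_hasPureDim (by omega) (by omega) D hD

end Abelian

section AbelianAnyModel

variable {ι : Type*} [Fintype ι] [DecidableEq ι] {E : Type*} [NormedAddCommGroup E] [NormedSpace ℂ E]
  [FiniteDimensional ℂ E] (Φ : (ι → ℝ) ≃L[ℝ] E)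

/-- **An abelian variety of positive dimension carries a closed analytic subset of pure codimension one** — any
finite-dimensional model. [cite: Lange2023AbelianVarietiesComplex, §1.5.4 Thm. 1.5.11 and §2.1.6 Exercise (10)(a)]
[cite: SwinnertonDyer1974AbelianVarieties, Ch. II §6] -/
theorem IsAbelianVariety.exists_hasPureCodim_one {Φ : (ι → ℝ) ≃L[ℝ] E} (hab : IsAbelianVariety Φ) (hg : 1 ≤ finrank ℂ E) :
    ∃ D : Set (ComplexTorus Φ), HasPureCodim 𝓘(ℂ, E) D 1 := by
  have hab' : IsAbelianVariety (euclideanPresentation Φ) := (isAbelianVariety_euclideanPresentation_iff Φ).2 hab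
  have hg' : 1 ≤ finrank ℂ (EuclideanSpace ℂ (Fin (finrank ℂ E))) := by rwa [finrank_euclideanSpace_fin]
  obtain ⟨D', hD'⟩ := hab'.exists_hasPureDim_of_inner hg'
  have hD := hD'.of_euclideanPresentation (Φ := Φ)
  obtain ⟨c, hc, hDc⟩ := hD
  rw [finrank_euclideanSpace_fin] at hc
  have hc1 : c = 1 := by omega
  subst hc1
  exact ⟨_, hDc⟩

/-- **A TORUS OF DIMENSION `g ≥ 2` WITHOUT SUBVARIETIES IS NOT AN ABELIAN VARIETY** — any finite-dimensional model.
[cite: Lange2023AbelianVarietiesComplex, §2.1.3 Prop. 2.1.11 and §4.1] [cite: Voisin2002KaehlerCounterexample, §3] -/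
theorem AnalyticSubsetsFinite.not_isAbelianVariety {Φ : (ι → ℝ) ≃L[ℝ] E} (h : AnalyticSubsetsFinite Φ)
    (hg : 2 ≤ finrank ℂ E) : ¬ IsAbelianVariety Φ := fun hab ↦ by
  obtain ⟨D, hD⟩ := hab.exists_hasPureCodim_one (by omega)
  exact h.not_hasPureCodim one_pos (by omega) D hD

/-- Hence the hypotheses of Ueno's theorem are also NECESSARY: for `g ≥ 2`,
`AnalyticSubsetsFinite Φ → IsSimple Φ ∧ ¬ IsAbelianVariety Φ`. [cite: Ueno1975, §10 Thm. 10.3 and Thm. 10.9] -/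
theorem AnalyticSubsetsFinite.isSimple_and_not_isAbelianVariety {Φ : (ι → ℝ) ≃L[ℝ] E} (h : AnalyticSubsetsFinite Φ)
    (hg : 2 ≤ finrank ℂ E) : IsSimple Φ ∧ ¬ IsAbelianVariety Φ :=
  ⟨h.isSimple, h.not_isAbelianVariety hg⟩

/-! ### §5 Dimension two: the characterisation, and Zucker's torus -/

/-- **A complex `2`-torus contains no proper closed analytic subset of positive dimension (no curve) IF AND ONLY IF it
is simple and not an abelian surface** (row A4-110 for `⇐`; §3–§4 for `⇒`). [cite: Ueno1975, §10 Thm. 10.3 and Thm. 10.9]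
[cite: Shafarevich1994, Ch. VIII §1.4 Examples 8.3–8.4] [cite: Lange2023AbelianVarietiesComplex, §2.1.3 Prop. 2.1.11] -/
theorem analyticSubsetsFinite_iff_isSimple_and_not_isAbelianVariety (h2 : finrank ℂ E = 2) :
    AnalyticSubsetsFinite Φ ↔ IsSimple Φ ∧ ¬ IsAbelianVariety Φ :=
  ⟨fun h ↦ h.isSimple_and_not_isAbelianVariety (by omega),
    fun h ↦ analyticSubsetsFinite_of_isSimple_of_finrank_eq_two Φ h2 h.1 h.2⟩

/-- Curve form: **a `2`-torus has no closed analytic subset of pure dimension one iff it is simple and not an abelian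
surface.** [cite: Ueno1975, §10 Thm. 10.3 and Thm. 10.9] [cite: Shafarevich1994, Ch. VIII §1.4 Examples 8.3–8.4] -/
theorem forall_not_hasPureDim_one_iff_isSimple_and_not_isAbelianVariety (h2 : finrank ℂ E = 2) :
    (∀ C : Set (ComplexTorus Φ), ¬ HasPureDim 𝓘(ℂ, E) C 1) ↔ IsSimple Φ ∧ ¬ IsAbelianVariety Φ := by
  rw [← analyticSubsetsFinite_iff_isSimple_and_not_isAbelianVariety Φ h2, analyticSubsetsFinite_iff_forall_not_hasPureDim]
  refine ⟨fun h d hd0 hd2 C ↦ ?_, fun h C ↦ h 1 one_pos (by omega) C⟩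
  have hd : d = 1 := by omega
  subst hd
  exact h C

end AbelianAnyModel

/-! ### §6 Every dimension: the very general torus `ℂ^g/(Zℤ^g ⊕ ℤ^g)` has no subvarieties (Baire form) -/

section General

variable {κ : Type*} [Fintype κ] [DecidableEq κ]

/-- **THE VERY GENERAL COMPLEX TORUS OF ANY DIMENSION CONTAINS NO PROPER CLOSED ANALYTIC SUBSET OF POSITIVE DIMENSION**:
for `Z` in a residual (comeagre) subset of `M_g(ℂ)` the torus `X_Z = ℂ^g/(Zℤ^g ⊕ ℤ^g)` (`periodIsoOfNormalForm Z`) has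
`Hg(X_Z) = SL_{2g}` (p17's `setOf_hodgeGroup_periodIsoOfNormalForm_eq_top_mem_residual`, Lange's Prop. 7.3.2 in Baire
form), hence (row A4-109) every closed analytic `Z' ≠ X_Z` is finite.
[cite: Lange2023AbelianVarietiesComplex, §7.3.1 Prop. 7.3.2 (proof, pp. 336–337) and §7.2.2 Thm. 7.2.4]
[cite: Shafarevich1994, Ch. VIII §1.4 Example 8.4] -/
theorem setOf_analyticSubsetsFinite_mem_residual :
    {Z : Matrix κ κ ℂ | ∃ h : (Z.map Complex.im).det ≠ 0, AnalyticSubsetsFinite (periodIsoOfNormalForm Z h)} ∈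
      residual (Matrix κ κ ℂ) := by
  refine Filter.mem_of_superset setOf_hodgeGroup_periodIsoOfNormalForm_eq_top_mem_residual ?_
  rintro Z ⟨h, hZ⟩
  exact ⟨h, analyticSubsetsFinite_of_hodgeGroup_eq_top (periodIsoOfNormalForm Z h) hZ⟩

/-- … in particular these period matrices are DENSE in `M_g(ℂ)`. [cite: Lange2023AbelianVarietiesComplex, §7.3.1 Prop. 7.3.2 (proof, pp. 336–337)] -/
theorem dense_setOf_analyticSubsetsFinite :
    Dense {Z : Matrix κ κ ℂ | ∃ h : (Z.map Complex.im).det ≠ 0, AnalyticSubsetsFinite (periodIsoOfNormalForm Z h)} := by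
  haveI : LocallyCompactSpace (Matrix κ κ ℂ) := inferInstanceAs (LocallyCompactSpace (κ → κ → ℂ))
  exact dense_of_mem_residual setOf_analyticSubsetsFinite_mem_residual

/-- **In every dimension `g` there is a complex torus `ℂ^g/Λ` without proper closed analytic subsets of positive
dimension** (with `Hg = SL_{2g}`; for `g ≥ 2` it is then simple and not an abelian variety, §3–§4).
[cite: Lange2023AbelianVarietiesComplex, §7.3.1 Prop. 7.3.2 (proof, pp. 336–337)] [cite: Shafarevich1994, Ch. VIII §1.4 Example 8.4] -/
theorem exists_analyticSubsetsFinite_of_dim (g : ℕ) :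
    ∃ Φ : (Fin g ⊕ Fin g → ℝ) ≃L[ℝ] (Fin g → ℂ), hodgeGroup Φ = ⊤ ∧ AnalyticSubsetsFinite Φ := by
  obtain ⟨Φ, hΦ⟩ := exists_hodgeGroup_eq_top_of_dim g
  exact ⟨Φ, hΦ, analyticSubsetsFinite_of_hodgeGroup_eq_top Φ hΦ⟩

end General

end ComplexTorus

/-! #### Zucker's torus `T₀ = ℂ²/L₀`: no curves, hence simple and non-algebraic -/

namespace Zucker

open ComplexTorus

/-- **Every proper closed analytic subset of Zucker's torus `T₀` is finite** (row A4-105: no analytic curve,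
`Zucker.not_hasPureDim_one`; dimension two). [cite: Zucker1977, Appendix B Theorem p. 208] -/
theorem analyticSubsetsFinite : AnalyticSubsetsFinite skewPeriodCLE :=
  analyticSubsetsFinite_of_forall_not_hasPureDim skewPeriodCLE fun d hd0 hd2 Z ↦ by
    have hg : finrank ℂ (Fin 2 → ℂ) = 2 := by simp
    have hd : d = 1 := by omega
    subst hd
    exact not_hasPureDim_one Z

/-- **Zucker's torus `T₀` is simple** (it contains no curve, in particular no elliptic curve).
[cite: Zucker1977, Appendix B Theorem p. 208] [cite: Ueno1975, §10 Thm. 10.3] -/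
theorem isSimple_skewPeriodCLE : IsSimple skewPeriodCLE :=
  analyticSubsetsFinite.isSimple

/-- **Zucker's torus `T₀` is not an abelian surface** (it carries no curve, in particular no theta divisor) — although
`B¹(T₀) = H²(T₀, ℚ) ∩ H^{1,1}` has dimension `2` (row A4-105: `A¹(T₀) = 0 ≠ B¹(T₀)`).
[cite: Zucker1977, Appendix B Proposition p. 207 and Theorem p. 208] [cite: Lange2023AbelianVarietiesComplex, §2.1.3 Prop. 2.1.11] -/
theorem not_isAbelianVariety_skewPeriodCLE : ¬ IsAbelianVariety skewPeriodCLE :=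
  analyticSubsetsFinite.not_isAbelianVariety (by simp)

end Zucker

end Literature.Geometry.Kaehler

end
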